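import Literature.MathematicalPhysics.QuantumFieldTheory.Balaban1983to89.Beta.RemainderDecay190HoloChain

/-!
# `Balaban1983to89.Beta.RemainderResidue` — the residue of the k-UNIFORM remainder bound (wall item (D4)) as NAMED hypothesis
shapes over the an4 socket in its holomorphic currency `ChainTFac190H`: at slope `s` (`AtSlope`) and its slope-free, box-free form uniform in the activity parameter `ε₁`
(`EpsUniform`), with the reductions to `RemainderChain.RemainderConst` and their non-vacuity
(cell pub-balaban-gaps, YM BLITZ track G1, seat g1-p2; a NEW LEAF over the an4 chain — nothing in the tree is edited)

HONEST FRAMING (cell rule, verbatim, page 1 of everything the β sub-cell writes): discharging `BetaPertH` makes Bałaban's UV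
stability UNCONDITIONAL — a real constructive-QFT result; it is NOT the continuum limit and NOT the Clay problem.  THIS MODULE
DISCHARGES NOTHING of the series.  The β-functions of a construction are FREE DATA of the cell's typing (`B12.RunData.flow`), so
the wall's item (D4) — `(hrem : RemainderConst Sβ γ₀ rr) (hr : rr ≤ s)` at the one-loop slope `s`, consumed by
`DriftRemainder.endpointExistence_of_drift_remainderConst_cont` / `OneStepKernelFamily.endpointExistence_of_D1Drift` — is a
HYPOTHESIS ON DATA, dischargeable only for a CONSTRUCTED instance of Bałaban's small-field step (the cell's NODE O; size XL; no
owner), never for an arbitrary construction.  What is recorded here is the statement-layer bookkeeping the cell brief asks for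
(«if the binder does not close, land the SHARPER residue as a named Prop»): two PREDICATES with free arguments (hypothesis
shapes, never asserted) and `[folklore]` real-number reasoning joining them BY NAME to theorems already in the tree
(`RemainderChain`, `RemainderChainLattice`, `RemainderDecay190`, `RemainderDecay190HoloChain`), none of which is modified.

ABSOLUTE RULE (cell charter, verbatim): "No internally-minted statement may enter as a cited fact.  Every hypothesis is either
kernel-proved in this package or a verbatim quotation of a PUBLISHED theorem with page reference.  The manuscript(s) under audit
are NOT citable for their own disputed steps — they are the thing under adjudication; programme-internal (2001/route/tribunal)
claims are never citable."  The `[cite: …]` tags below are CONTEXT ONLY (which printed display a hypothesis SHAPE types); no tag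
imports a fact.

CITATION HEADER (lean-in-tree rule 2026-08-18).  [I] = T. Bałaban, *Renormalization group approach to lattice gauge field
theories. I. Generation of effective actions in a small field approximation and a coupling constant renormalization in four
dimensions*, Commun. Math. Phys. **109** (1987) 249–301 [Balaban1987RG1]: Thm 2 p. 259; Thm 3 p. 264 *"There exist positive
constants … such, that … The constant γ depends on all other constants."*; (1.20)–(1.22) p. 264; (4.4) p. 281; (4.35) p. 290;
(5.10) p. 293.  [II] = T. Bałaban, *Renormalization group approach to lattice gauge field theories. II. Cluster expansions*,
Commun. Math. Phys. **116** (1988) 1–22 [Balaban1988RG2Cluster]: Lemma 3 (2.38) p. 20; p. 21 after (2.39) *"for κ sufficiently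
large, and ε₁ sufficiently small"*.  [15] = T. Bałaban, *The variational problem and background fields in renormalization group
method for lattice gauge theories*, Commun. Math. Phys. **102** (1985) 277–309 [Balaban1985Variational]: (190) p. 308.  The
quotations are those certified (render-checked) in the imported an4 modules `RemainderChain`, `RemainderChainLattice`,
`RemainderDecay190`; nothing is newly quoted here.

## What is here

§1 the constant form restricts to smaller boxes (`remainderConst_restrict`; γ is chosen last, [I] Thm 3 p. 264) and the
wall's PAIR `(∃ rr, RemainderConst Sβ γ₀ rr ∧ rr ≤ s)` IS the single hypothesis `RemainderConst Sβ γ₀ s` (`wallPair_iff`) —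
item (D4) is ONE binder.  §1b the ONE-SIDED quarters (cell skeleton SK-W/SK-D4r stubs SK-D4r-1/2): SK-D4r-1 IS the tree's
`DriftRemainder.betaUpperH_of_drift_oneSided` (re-exported by name), SK-D4r-2 = `upperConst_nonneg_oneSided` (sign of the derived upper
constant from one-sided data), and `partialSums_and_upper_of_quarters` ((PS) ∧ (UP) from drift + the two quarters + `r ≤ b`).
§1c `WindowedLower Sβ γ₀ r M'` — the WEAKEST (D4)-currency the drift road consumes (windowed lower sums of β¹ with rate `r` and
defect `M'`; ROUTES-PLAN-2 §1 row D4 «not typed» — typed here): `betaPartialSumsLowerH_of_drift_windowedLower` ((PS) with `2A + M'`).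

CURRENCY: every predicate below is stated over the HOLOMORPHIC-currency socket `RemainderDecay190HoloChain.ChainTFac190H` (holomorphy of the
(4.4)-seam functional as `DifferentiableOn ℂ`, the currency of record p250623 — print-faithful and WEAKER than the analytic currency
`RemainderDecay190.ChainTFac190`, which maps into it by `ChainTFac190H.ofAnalytic`; cell file `pub-balaban-gaps/g1/G1-PLAN-D4.md` §3.1 note);
the END `ChainTFac190H.abs_beta1_le` has the same letters.  `atSlope_of_chainTFac190` accepts an analytic-currency inhabitant.

§2 `AtSlope Sβ γ₀ s` — THE RESIDUE AT SLOPE `s`: an inhabitant of the an4 socket `RemainderDecay190HoloChain.ChainTFac190H 4 M μ ν Sβ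
γ₀ c ℓ α₂ q` (Bałaban's one-step objects over an exhausting torus family with the printed leaves as displayed hypothesis fields: [II]
Lemma 3 (2.38) on the resummed activities, [I] (4.4) analyticity, (4.35), the p. 282 decay from [15] (190) + [3] (2.61), the
(1.7) factorization, the (1.20)–(1.22) read-out of `Sβ.β1` — the cell's leaf ledger L1–L11) with the numeric side conditions
N1–N3 (`CondsL`, `R22gen`, `Consts190.Valid`, `SignsL`, `ε₁ · K_rem,L ≤ s`); `remainderConst_of_atSlope` = ONE application of
`ChainTFac190H.abs_beta1_le`.

§3 `EpsUniform Sβ` — THE SHARPER RESIDUE, free of the slope, of the box size and of all one-loop data: the objects exist FOR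
EVERY activity parameter `ε₁ ∈ ]0, ε₀]` on SOME box `]0, γ₀(ε₁)]^{k+1}`, with `K_rem,L` bounded UNIFORMLY in `ε₁` — the printed
order of constants ([II] p. 21 before (2.40); [I] Thm 3 p. 264) made a displayed quantifier.  `exists_atSlope_of_epsUniform`,
`exists_remainderConst_of_epsUniform`: it yields (D4) AT EVERY POSITIVE SLOPE on some box (`ε₁ := min ε₀ (s/K)`), so it composes
with whatever one-loop slope the drift rows deliver; boxes are then intersected with the continuity box (both antitone).

§4 `ObjectsUniform Sβ` — THE PURE OBJECT RESIDUE: the numeric side conditions N1–N3 are discharged GENERICALLY in the activity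
parameter (`condsL_constsAt`: only `CondsL.small` mentions `ε₁`, monotonically; `remCoeffL_constsAt`: `K_rem,L` is `ε₁`-free by `rfl`),
so what remains is ONE record meeting N1–N2 and, for every smaller activity `e`, an inhabitant of the chain at `constsAt c e` on some
box — `epsUniform_of_objectsUniform`, `exists_remainderConst_le_of_objectsUniform`.  THIS is the exact missing lemma of wall item (D4)
for Bałaban's split: `ObjectsUniform Sβ` (cell census `pub-balaban-gaps/g1/RESIDUE.md` §D4).

NON-VACUITY (all three predicates inhabited at `RemainderWitness`'s zero-activity point, split `splitZero`) and the compositions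
with the wall END are kernel-checked in the cell's Summits-side file `Summits/QuantumFields/BalabanUV/Gaps/D4Residue.lean`
(`atSlope_splitZero`, `epsUniform_splitZero`, `objectsUniform_splitZero`, `endpointExistence_of_D1Drift_objectsUniform`).  For Bałaban's split: 0 instances
(cell records `BETA/REMAINDER-BETA.md` §8, `b2b-balaban-beta-an4/D4-CRUX-SOCKETS.md`).

## What is NOT here

No object of Bałaban's is constructed; no leaf is discharged; the downstream one-sided / partial-sum forms
(`ChainTFac190.neg_le_beta1`, `DriftRemainder.endpointExistence_of_drift_oneSided`) are in the tree and not renamed.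
No `sorry`, no axiom beyond the standard trio, no fact minted.
-/

namespace Literature.MathematicalPhysics.QuantumFieldTheory.Balaban1983to89.Beta.RemainderResidue

open Literature.MathematicalPhysics.QuantumFieldTheory.Balaban1983to89
open FlowStep
open Literature.MathematicalPhysics.QuantumFieldTheory.Balaban1983to89.Beta.RemainderChain (RemainderConst)
open Literature.MathematicalPhysics.QuantumFieldTheory.Balaban1983to89.Beta.RemainderChainLattice (CondsL SignsL remCoeffL)
open Literature.MathematicalPhysics.QuantumFieldTheory.Balaban1983to89.Beta.RemainderDecay190 (Consts190 ChainTFac190)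
open Literature.MathematicalPhysics.QuantumFieldTheory.Balaban1983to89.Beta.RemainderDecay190HoloChain (ChainTFac190H)

noncomputable section

/-! ## §1. The constant form is monotone in the constant and antitone in the box; the wall's pair is ONE hypothesis -/

/-- Monotonicity of the constant form in the constant: `|β¹| ≤ r ≤ s` on the boxes gives `|β¹| ≤ s` (private plumbing; the
public form is `wallPair_iff`). [folklore] -/
private theorem remainderConst_of_le {β : HBeta} {S : B12Beta.OneLoopSplit β} {γ r s : ℝ} (h : RemainderConst S γ r) (hrs : r ≤ s) :
    RemainderConst S γ s := fun k p hp => (h k p hp).trans hrs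

/-- Histories in a smaller box lie in the larger box (private plumbing). [folklore] -/
private theorem histBox_mono {γ γ' : ℝ} (h : γ ≤ γ') (k : ℕ) : B12Beta.HistBox γ k ⊆ B12Beta.HistBox γ' k :=
  fun _ hp i => ⟨(hp i).1, (hp i).2.trans h⟩

/-- The constant form is ANTITONE in the box size: a bound on `]0,γ']^{k+1}` restricts to `]0,γ]^{k+1}`, `γ ≤ γ'` (private
plumbing; the public form is `remainderConst_restrict`). [folklore] -/
private theorem remainderConst_anti {β : HBeta} {S : B12Beta.OneLoopSplit β} {γ γ' r : ℝ} (hγ : γ ≤ γ') (h : RemainderConst S γ' r) :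
    RemainderConst S γ r := fun k p hp => h k p (histBox_mono hγ k hp)

/-- **The constant form restricts to every smaller box** (`γ ≤ γ'`): the coupling interval `]0, γ]` is chosen AFTER all other
constants ([I] Thm 3 p. 264 *"The constant γ depends on all other constants."*), so a bound established on `]0,γ']^{k+1}` is used
on any `]0,γ]^{k+1}`, `γ ≤ γ'` — in particular on the intersection with the box of the continuity hypothesis (C).
[cite: Balaban1987RG1, Thm 3 p.264] -/
theorem remainderConst_restrict {β : HBeta} {S : B12Beta.OneLoopSplit β} {γ γ' r : ℝ} (hγ : γ ≤ γ')
    (h : RemainderConst S γ' r) : RemainderConst S γ r := remainderConst_anti hγ h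

/-- **The wall's binder pair `(hrem : RemainderConst Sβ γ₀ rr) (hr : rr ≤ s)` IS the single hypothesis `RemainderConst Sβ γ₀ s`**
(take `rr := s`; conversely monotonicity).  With `s` the one-loop slope this is item (D4) of the wall ENDs
`DriftRemainder.endpointExistence_of_drift_remainderConst_cont` / `OneStepKernelFamily.endpointExistence_of_D1Drift` by name.
[cite: Balaban1987RG1, Thm 2 p.259] -/
theorem wallPair_iff {β : HBeta} (S : B12Beta.OneLoopSplit β) (γ₀ s : ℝ) :
    (∃ rr : ℝ, RemainderConst S γ₀ rr ∧ rr ≤ s) ↔ RemainderConst S γ₀ s :=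
  ⟨fun ⟨_, h, hr⟩ => remainderConst_of_le h hr, fun h => ⟨s, h, le_rfl⟩⟩

/-! ## §1b. The ONE-SIDED quarters of (D4) (cell skeleton SK-W / SK-D4r, stubs SK-D4r-1/2): `−r ≤ β¹` is the load-bearing half
(with `r ≤ s`, `DriftRemainder.betaPartialSumsLowerH_of_drift_oneSided`); `β¹ ≤ r'` only feeds the printed-type upper bound (UP) -/

/-- **SK-D4r-1 = the tree's `DriftRemainder.betaUpperH_of_drift_oneSided`, by name**: a drift of the one-loop coefficients
(`|Σ_{j<k} β⁰_j − b k| ≤ A`, hence `β⁰_k ≤ b + 2A`) and the UPPER quarter `β¹_{k+1} ≤ r'` on the `]0,γ₀]`-boxes give the printed-type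
uniform upper bound `β_{k+1} ≤ b + 2A + r'` ([I] §1 p. 264 "uniformly bounded"). [cite: Balaban1987RG1, §1 p.264 and (2.12)-(2.14) p.268] -/
theorem betaUpperH_of_drift_upperOneSided {β : HBeta} (S : B12Beta.OneLoopSplit β) {b A r' γ₀ : ℝ}
    (hdrift : Drift.OneLoopDrift b A S.β0)
    (hup1 : ∀ k (p : Fin (k + 1) → ℝ), p ∈ B12Beta.HistBox γ₀ k → S.β1 k p ≤ r') :
    BetaUpperH (b + 2 * A + r') γ₀ β :=
  DriftRemainder.betaUpperH_of_drift_oneSided S hdrift hup1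

/-- **SK-D4r-2: the sign of the derived upper constant from ONE-SIDED data**: on a non-empty box (`0 < γ₀`), a drift (so `0 ≤ A`),
the two quarters `−r ≤ β¹_{k+1} ≤ r'` on the boxes and `r ≤ b` give `0 ≤ b + 2A + r'` (test the constant history `(γ₀)` at scale 0:
`r' ≥ −r ≥ −b`).  The one-sided twin of `DriftRemainder.upperConst_nonneg`. [cite: Balaban1987RG1, §1 p.264 and Thm 2 p.259] -/
theorem upperConst_nonneg_oneSided {β : HBeta} (S : B12Beta.OneLoopSplit β) {b A r r' γ₀ : ℝ} (hγ₀ : 0 < γ₀)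
    (hdrift : Drift.OneLoopDrift b A S.β0)
    (hlow : ∀ k (p : Fin (k + 1) → ℝ), p ∈ B12Beta.HistBox γ₀ k → -r ≤ S.β1 k p)
    (hup1 : ∀ k (p : Fin (k + 1) → ℝ), p ∈ B12Beta.HistBox γ₀ k → S.β1 k p ≤ r') (hr : r ≤ b) :
    0 ≤ b + 2 * A + r' := by
  have hp : (fun _ : Fin (0 + 1) => γ₀) ∈ B12Beta.HistBox γ₀ 0 := fun _ => ⟨hγ₀, le_rfl⟩
  have h1 := hlow 0 _ hp
  have h2 := hup1 0 _ hp
  linarith [hdrift.nonneg]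

/-- **The two quarters give the wall's consumable data**: drift + `−r ≤ β¹ ≤ r'` on the boxes + `r ≤ b` ⟹ (PS) partial sums `≥ −2A`
(`DriftRemainder.betaPartialSumsLowerH_of_drift_oneSided`) ∧ (UP) with `β' = b + 2A + r' ≥ 0` — so (D4) may be filed as TWO one-sided
k-uniform bounds, of which only the lower one is coupled to the slope. [cite: Balaban1987RG1, Thm 2 p.259 and §1 p.264] -/
theorem partialSums_and_upper_of_quarters {β : HBeta} (S : B12Beta.OneLoopSplit β) {b A r r' γ₀ : ℝ} (hγ₀ : 0 < γ₀)
    (hdrift : Drift.OneLoopDrift b A S.β0)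
    (hlow : ∀ k (p : Fin (k + 1) → ℝ), p ∈ B12Beta.HistBox γ₀ k → -r ≤ S.β1 k p)
    (hup1 : ∀ k (p : Fin (k + 1) → ℝ), p ∈ B12Beta.HistBox γ₀ k → S.β1 k p ≤ r') (hr : r ≤ b) :
    FlowStepRuns.BetaPartialSumsLowerH (2 * A) γ₀ β ∧ BetaUpperH (b + 2 * A + r') γ₀ β ∧ 0 ≤ b + 2 * A + r' :=
  ⟨DriftRemainder.betaPartialSumsLowerH_of_drift_oneSided S hdrift hlow hr, betaUpperH_of_drift_upperOneSided S hdrift hup1,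
    upperConst_nonneg_oneSided S hγ₀ hdrift hlow hup1 hr⟩

/-! ## §1c. The WEAKEST (D4)-currency the drift road consumes: WINDOWED lower sums of β¹ along `]0,γ₀]`-histories
(ROUTES-PLAN-2 §1 row D4 col. 4, «weaker still (not typed)» — typed here) -/

/-- **`WindowedLower Sβ γ₀ r M'` — the windowed one-sided form of (D4)**: along every `]0,γ₀]`-valued coupling sequence `g` and for
all `k ≤ n`, `Σ_{j∈[k,n)} β¹_{j+1}(g_0,…,g_j) ≥ −(M' + r·(n − k))` — a LINEAR-IN-THE-WINDOW lower budget with rate `r` and defect `M'`.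
Weaker than the pointwise `−r ≤ β¹` (`windowedLower_of_lower`, `M' = 0`), a fortiori than `RemainderConst Sβ γ₀ r`.  A PREDICATE
(hypothesis shape), never asserted. [cite: Balaban1987RG1, Thm 2 p.259 and (2.12)-(2.14) p.268] -/
def WindowedLower {β : HBeta} (Sβ : B12Beta.OneLoopSplit β) (γ₀ r M' : ℝ) : Prop :=
  ∀ g : ℕ → ℝ, (∀ i, 0 < g i ∧ g i ≤ γ₀) → ∀ k n : ℕ, k ≤ n →
    -(M' + r * ((n : ℝ) - k)) ≤ ∑ j ∈ Finset.Ico k n, Sβ.β1 j (prefixOf g j)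

/-- The pointwise one-sided bound gives the windowed form with zero defect. [cite: Balaban1987RG1, Thm 2 p.259] -/
theorem windowedLower_of_lower {β : HBeta} (Sβ : B12Beta.OneLoopSplit β) {γ₀ r : ℝ}
    (hlow : ∀ k (p : Fin (k + 1) → ℝ), p ∈ B12Beta.HistBox γ₀ k → -r ≤ Sβ.β1 k p) : WindowedLower Sβ γ₀ r 0 := by
  intro g hg k n hkn
  have hstep : ∀ j ∈ Finset.Ico k n, -r ≤ Sβ.β1 j (prefixOf g j) := fun j _ => hlow j _ fun i => hg i
  have hsum := Finset.sum_le_sum hstep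
  rw [Finset.sum_const, Nat.card_Ico, nsmul_eq_mul, Nat.cast_sub hkn] at hsum
  linarith

/-- The two-sided constant form gives the windowed form with zero defect. [cite: Balaban1987RG1, Thm 2 p.259] -/
theorem windowedLower_of_remainderConst {β : HBeta} (Sβ : B12Beta.OneLoopSplit β) {γ₀ r : ℝ}
    (hrem : RemainderConst Sβ γ₀ r) : WindowedLower Sβ γ₀ r 0 :=
  windowedLower_of_lower Sβ fun k p hp => (abs_le.mp (hrem k p hp)).1

/-- **DRIFT + WINDOWED (D4) ⟹ (PS)**: a drift of the one-loop coefficients with slope `b` and defect `A`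
(`Σ_{j∈[k,n)} β⁰_j ≥ b(n−k) − 2A`, `Drift.sum_Ico_ge_of_drift`) and the windowed lower form with rate `r ≤ b` and defect `M'` give
bounded-below partial sums of β with `M = 2A + M'` — the binder of `FlowStepRuns.endpointExistence_of_partialSums`.  Only `r ≤ b`
couples the two rows. [cite: Balaban1987RG1, Thm 2 p.259 (first sentence) and (2.12)-(2.14) p.268] -/
theorem betaPartialSumsLowerH_of_drift_windowedLower {β : HBeta} (Sβ : B12Beta.OneLoopSplit β) {b A r M' γ₀ : ℝ}
    (hdrift : Drift.OneLoopDrift b A Sβ.β0) (hwin : WindowedLower Sβ γ₀ r M') (hr : r ≤ b) :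
    FlowStepRuns.BetaPartialSumsLowerH (2 * A + M') γ₀ β := by
  intro g hg k n hkn
  have h1 := hwin g hg k n hkn
  have h0 := Drift.sum_Ico_ge_of_drift hdrift hkn
  have hsplit : ∑ j ∈ Finset.Ico k n, β j (prefixOf g j) =
      ∑ j ∈ Finset.Ico k n, Sβ.β0 j + ∑ j ∈ Finset.Ico k n, Sβ.β1 j (prefixOf g j) := by
    rw [← Finset.sum_add_distrib]
    exact Finset.sum_congr rfl fun j _ => Sβ.split j _
  have hnk : (0 : ℝ) ≤ (n : ℝ) - k := by
    have : (k : ℝ) ≤ n := by exact_mod_cast hkn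
    linarith
  rw [hsplit]
  nlinarith [h1, h0, hnk, hr]

/-! ## §2. The residue AT SLOPE `s`: an inhabitant of the an4 socket with its numeric side conditions -/

/-- **`AtSlope Sβ γ₀ s` — the residue of the k-uniform remainder bound at slope `s` on the boxes `]0,γ₀]^{k+1}`** (d = 4): for
some cube side `M`, channel `(μ, ν)`, [II]-constant record `c`, transfer factor `ℓ`, (4.4)-radius `α₂` and (190)-constant record
`q`, an INHABITANT of the torus remainder chain `ChainTFac190H 4 M μ ν Sβ γ₀ c ℓ α₂ q` (holomorphic currency; Bałaban's one-step objects on an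
exhausting torus family with the printed leaves as hypothesis fields: [II] Lemma 3 (2.38) on the resummed activities, [I] (4.4)
analyticity, (4.35), the p. 282 decay from [15] (190) + (2.61), the (1.7) factorization, the (1.20)–(1.22) read-out of `Sβ.β1`),
with the side conditions `CondsL` («κ sufficiently large, ε₁ sufficiently small», the O(1) of (2.41)), the closing relation
`R22gen` («(1 − 10δ)ℓ = 1»), the (190)-signs `Consts190.Valid`, the sign record `SignsL`, and the ONE extra restriction of
printed type `ε₁ · K_rem,L(4, M, c, α₂, B₃(q)) ≤ s`.  A PREDICATE (hypothesis shape), never asserted; for Bałaban's split no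
inhabitant exists in the tree.
[cite: Balaban1988RG2Cluster, Lemma 3 (2.38) p.20 and p.21; Balaban1987RG1, (1.20)-(1.22) p.264, (4.4) p.281, (4.35) p.290; Balaban1985Variational, (190) p.308] -/
def AtSlope {β : HBeta} (Sβ : B12Beta.OneLoopSplit β) (γ₀ s : ℝ) : Prop :=
  ∃ (M : ℕ) (_ : NeZero M) (μ ν : Fin 4) (c : B13.Consts) (ℓ α₂ : ℝ) (q : Consts190),
    Nonempty (ChainTFac190H 4 M μ ν Sβ γ₀ c ℓ α₂ q) ∧ CondsL 4 c ℓ ∧ c.R22gen ℓ ∧ q.Valid c.δ₀ ∧ SignsL c α₂ q.B₃ ∧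
      c.ε₁ * remCoeffL 4 M c α₂ q.B₃ ≤ s

/-- **Residue at slope `s` ⟹ the constant form `RemainderConst Sβ γ₀ s`** — ONE application of the an4 END
`ChainTFac190H.abs_beta1_le` (`|β¹_{k+1}| ≤ ε₁ · K_rem,L` for every scale and history) and monotonicity in the constant.
[cite: Balaban1988RG2Cluster, (2.38) p.20; Balaban1987RG1, (5.10) p.293 and (1.22) p.264] -/
theorem remainderConst_of_atSlope {β : HBeta} {Sβ : B12Beta.OneLoopSplit β} {γ₀ s : ℝ} (h : AtSlope Sβ γ₀ s) :
    RemainderConst Sβ γ₀ s := by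
  obtain ⟨M, _, μ, ν, c, ℓ, α₂, q, ⟨R⟩, hC, h22, hq, hs, hε⟩ := h
  exact remainderConst_of_le (R.abs_beta1_le hC h22 hq hs (by norm_num)) hε

/-- With the wall's letters: the residue at slope `s` supplies the PAIR `(hrem, hr)`. [cite: Balaban1987RG1, Thm 2 p.259] -/
theorem wallPair_of_atSlope {β : HBeta} {Sβ : B12Beta.OneLoopSplit β} {γ₀ s : ℝ} (h : AtSlope Sβ γ₀ s) :
    ∃ rr : ℝ, RemainderConst Sβ γ₀ rr ∧ rr ≤ s :=
  (wallPair_iff Sβ γ₀ s).2 (remainderConst_of_atSlope h)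

/-- **An ANALYTIC-currency inhabitant serves**: a chain `ChainTFac190 4 M μ ν Sβ γ₀ c ℓ α₂ q` (holomorphy as `AnalyticOnNhd ℂ`) with the
side conditions and the smallness clause gives the residue at slope `s` (via `ChainTFac190H.ofAnalytic`).
[cite: Balaban1987RG1, (4.4) p.281; Balaban1988RG2Cluster, (2.38) p.20] -/
theorem atSlope_of_chainTFac190 {β : HBeta} {Sβ : B12Beta.OneLoopSplit β} {γ₀ s : ℝ} {M : ℕ} [NeZero M] {μ ν : Fin 4}
    {c : B13.Consts} {ℓ α₂ : ℝ} {q : Consts190} (R : ChainTFac190 4 M μ ν Sβ γ₀ c ℓ α₂ q) (hC : CondsL 4 c ℓ)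
    (h22 : c.R22gen ℓ) (hq : q.Valid c.δ₀) (hs : SignsL c α₂ q.B₃) (hsmall : c.ε₁ * remCoeffL 4 M c α₂ q.B₃ ≤ s) :
    AtSlope Sβ γ₀ s :=
  ⟨M, inferInstance, μ, ν, c, ℓ, α₂, q, ⟨ChainTFac190H.ofAnalytic R⟩, hC, h22, hq, hs, hsmall⟩

/-! ## §3. THE SHARPER RESIDUE `EpsUniform`: the objects for EVERY small activity parameter `ε₁`, `K_rem,L` uniform in `ε₁` -/

/-- **`EpsUniform Sβ` — the slope-free, box-free residue of the k-uniform remainder bound** (d = 4): there are a cube side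
`M`, a channel `(μ, ν)`, a transfer factor `ℓ`, a (4.4)-radius `α₂`, a (190)-record `q`, a bound `K` and a threshold
`ε₀ > 0`, and for every activity parameter `ε₁ ∈ ]0, ε₀]` a [II]-constant record `cOf ε₁` WITH THAT `ε₁` (`(cOf ε₁).ε₁ = ε₁`)
meeting the side conditions, with remainder coefficient `K_rem,L(4, M, cOf ε₁, α₂, B₃(q)) ≤ K` UNIFORMLY IN `ε₁`, and a box
size `γ₀ = γ₀(ε₁) > 0` on which the torus remainder chain `ChainTFac190H 4 M μ ν Sβ γ₀ (cOf ε₁) ℓ α₂ q` (holomorphic currency) is inhabited.  This is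
the printed ORDER OF CONSTANTS made a displayed quantifier: [II] p. 21 *"for κ sufficiently large, and ε₁ sufficiently small"*
(Lemma 3 holds with activity `C₃ε₁` for every small `ε₁`), [I] Thm 3 p. 264 *"The constant γ depends on all other constants"*
(the coupling box is chosen after `ε₁`).  A PREDICATE (hypothesis shape), never asserted; for Bałaban's split no inhabitant
exists in the tree — its inhabitation IS the construction of Bałaban's small-field one-step objects with the leaves of the
cell's ledger (L1–L11), uniformly in `ε₁`.
[cite: Balaban1988RG2Cluster, Lemma 3 (2.38) p.20 and p.21; Balaban1987RG1, Thm 3 p.264 and (1.20)-(1.22) p.264; Balaban1985Variational, (190) p.308] -/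
def EpsUniform {β : HBeta} (Sβ : B12Beta.OneLoopSplit β) : Prop :=
  ∃ (M : ℕ) (_ : NeZero M) (μ ν : Fin 4) (ℓ α₂ : ℝ) (q : Consts190) (K ε₀ : ℝ) (cOf : ℝ → B13.Consts),
    0 < ε₀ ∧ ∀ e : ℝ, 0 < e → e ≤ ε₀ →
      (cOf e).ε₁ = e ∧ CondsL 4 (cOf e) ℓ ∧ (cOf e).R22gen ℓ ∧ q.Valid (cOf e).δ₀ ∧ SignsL (cOf e) α₂ q.B₃ ∧
        remCoeffL 4 M (cOf e) α₂ q.B₃ ≤ K ∧ ∃ γ₀ : ℝ, 0 < γ₀ ∧ Nonempty (ChainTFac190H 4 M μ ν Sβ γ₀ (cOf e) ℓ α₂ q)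

/-- **The sharper residue gives the slope-`s` residue on some box, for EVERY `s > 0`** (choose `ε₁ := min ε₀ (s / K)` when
`K > 0`, `ε₁ := ε₀` otherwise). [cite: Balaban1988RG2Cluster, p.21 (after (2.39))] -/
theorem exists_atSlope_of_epsUniform {β : HBeta} {Sβ : B12Beta.OneLoopSplit β} (h : EpsUniform Sβ) {s : ℝ} (hs : 0 < s) :
    ∃ γ₀ : ℝ, 0 < γ₀ ∧ AtSlope Sβ γ₀ s := by
  obtain ⟨M, hM, μ, ν, ℓ, α₂, q, K, ε₀, cOf, hε₀, hall⟩ := h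
  -- the activity parameter: `min ε₀ (s / K)` if `K > 0`, else `ε₀`
  obtain ⟨e, he, heε, heK⟩ : ∃ e : ℝ, 0 < e ∧ e ≤ ε₀ ∧ e * K ≤ s := by
    by_cases hK : 0 < K
    · refine ⟨min ε₀ (s / K), lt_min hε₀ (div_pos hs hK), min_le_left _ _, ?_⟩
      calc min ε₀ (s / K) * K ≤ s / K * K := mul_le_mul_of_nonneg_right (min_le_right _ _) hK.le
        _ = s := div_mul_cancel₀ s hK.ne'
    · exact ⟨ε₀, hε₀, le_rfl, (mul_nonpos_iff.mpr (Or.inl ⟨hε₀.le, not_lt.mp hK⟩)).trans hs.le⟩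
  obtain ⟨hε₁, hC, h22, hq, hsg, hKe, γ₀, hγ₀, hR⟩ := hall e he heε
  refine ⟨γ₀, hγ₀, M, hM, μ, ν, cOf e, ℓ, α₂, q, hR, hC, h22, hq, hsg, ?_⟩
  rw [hε₁]
  exact (mul_le_mul_of_nonneg_left hKe he.le).trans heK

/-- **The sharper residue gives the constant form AT EVERY POSITIVE SLOPE on some box** — hence item (D4) at whatever one-loop
slope the drift rows deliver. [cite: Balaban1987RG1, Thm 2 p.259; Balaban1988RG2Cluster, (2.38) p.20 and p.21] -/
theorem exists_remainderConst_of_epsUniform {β : HBeta} {Sβ : B12Beta.OneLoopSplit β} (h : EpsUniform Sβ) {s : ℝ} (hs : 0 < s) :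
    ∃ γ₀ : ℝ, 0 < γ₀ ∧ RemainderConst Sβ γ₀ s := by
  obtain ⟨γ₀, hγ₀, hres⟩ := exists_atSlope_of_epsUniform h hs
  exact ⟨γ₀, hγ₀, remainderConst_of_atSlope hres⟩

/-- The same on a PRESCRIBED smaller box: for every `s > 0` and every `γc > 0` the constant form holds at slope `s` on
`]0, min γ₀ γc]` for the produced `γ₀` (antitone in the box) — the form in which it meets a continuity hypothesis given on
`]0, γc]` ([I] Thm 3 p. 264: γ is chosen after all other constants). [cite: Balaban1987RG1, Thm 3 p.264 and Thm 2 p.259] -/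
theorem exists_remainderConst_le_of_epsUniform {β : HBeta} {Sβ : B12Beta.OneLoopSplit β} (h : EpsUniform Sβ) {s γc : ℝ}
    (hs : 0 < s) (hγc : 0 < γc) : ∃ γ₁ : ℝ, 0 < γ₁ ∧ γ₁ ≤ γc ∧ RemainderConst Sβ γ₁ s := by
  obtain ⟨γ₀, hγ₀, hR⟩ := exists_remainderConst_of_epsUniform h hs
  exact ⟨min γ₀ γc, lt_min hγ₀ hγc, min_le_right _ _, remainderConst_anti (min_le_left _ _) hR⟩

/-! ## §4. THE PURE OBJECT RESIDUE `ObjectsUniform`: every numeric side condition discharged generically in `ε₁`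

If the side conditions N1–N2 hold for ONE [II]-record `c` (at its own activity parameter `c.ε₁ > 0`), they hold for the record
with ANY smaller activity parameter `e ∈ ]0, c.ε₁]` and every other letter unchanged (`constsAt c e`), and the remainder
coefficient `K_rem,L` does not see `ε₁` at all.  So `EpsUniform Sβ` follows from the PURELY OBJECT-LEVEL statement
`ObjectsUniform Sβ`: ONE record meeting N1–N2 and, for every smaller activity, an inhabitant of the chain on some box. -/

/-- The [II]-constant record `c` with its activity parameter `ε₁` replaced by `e`, every other letter unchanged (non-Prop
plumbing). [cite: Balaban1988RG2Cluster, p.21 (after (2.39))] -/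
def constsAt (c : B13.Consts) (e : ℝ) : B13.Consts := { c with ε₁ := e }

/-- `(constsAt c e).ε₁ = e`. [folklore] -/
private theorem constsAt_eps1 (c : B13.Consts) (e : ℝ) : (constsAt c e).ε₁ = e := rfl

/-- The activity constant `C₃` does not see `ε₁`. [folklore] -/
private theorem constsAt_C3act (c : B13.Consts) (e : ℝ) : (constsAt c e).C3act = c.C3act := rfl

/-- **`K_rem,L` does not see `ε₁`**: the closed coefficient `remCoeffL d M c α₂ B₃ = A₂·C₃·β′_d(K_Π,L, δ₁)` depends on `c` only
through `A₂, C₃` (i.e. `L, A₁, E₀, K₀`), `κ, δ₀` — by `rfl`. [cite: Balaban1987RG1, (5.10) p.293; Balaban1988RG2Cluster, (2.41) p.21] -/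
theorem remCoeffL_constsAt (d M : ℕ) (c : B13.Consts) (e α₂ B₃ : ℝ) :
    remCoeffL d M (constsAt c e) α₂ B₃ = remCoeffL d M c α₂ B₃ := rfl

/-- **N1 for every smaller activity**: `CondsL d c ℓ` («κ sufficiently large, ε₁ sufficiently small, A₂ ≥ threshold, 2κ₀ ≤ κ») at the
record `c` with `0 ≤ C₃` gives `CondsL d (constsAt c e) ℓ` for every `e ≤ c.ε₁` (only the `small` field mentions `ε₁`, monotonically).
[cite: Balaban1988RG2Cluster, p.21 (after (2.39))] -/
theorem condsL_constsAt {d : ℕ} {c : B13.Consts} {ℓ : ℝ} (hC : CondsL d c ℓ) (hC3 : 0 ≤ c.C3act) {e : ℝ}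
    (hle : e ≤ c.ε₁) : CondsL d (constsAt c e) ℓ := by
  refine ⟨hC.large, ?_, hC.A₂, hC.tree⟩
  have hK := B12TreeDecay.K₀_pos (4 * 2 ^ d) (2 * d)
  have hX : 0 ≤ Real.exp (5 * c.κ + 1) * B12TreeDecay.K₀ (4 * 2 ^ d) (2 * d) * (2 * (d : ℝ) + 1) * (4 * 2 ^ d) := by
    positivity
  have h1 : c.C3act * e ≤ c.C3act * c.ε₁ := mul_le_mul_of_nonneg_left hle hC3
  show c.C3act * e * Real.exp (5 * c.κ + 1) * B12TreeDecay.K₀ (4 * 2 ^ d) (2 * d) * (2 * (d : ℝ) + 1) * (4 * 2 ^ d) ≤ 1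
  calc c.C3act * e * Real.exp (5 * c.κ + 1) * B12TreeDecay.K₀ (4 * 2 ^ d) (2 * d) * (2 * (d : ℝ) + 1) * (4 * 2 ^ d)
      = c.C3act * e * (Real.exp (5 * c.κ + 1) * B12TreeDecay.K₀ (4 * 2 ^ d) (2 * d) * (2 * (d : ℝ) + 1) * (4 * 2 ^ d)) := by
        ring
    _ ≤ c.C3act * c.ε₁ * (Real.exp (5 * c.κ + 1) * B12TreeDecay.K₀ (4 * 2 ^ d) (2 * d) * (2 * (d : ℝ) + 1) * (4 * 2 ^ d)) :=
        mul_le_mul_of_nonneg_right h1 hX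
    _ = c.C3act * c.ε₁ * Real.exp (5 * c.κ + 1) * B12TreeDecay.K₀ (4 * 2 ^ d) (2 * d) * (2 * (d : ℝ) + 1) * (4 * 2 ^ d) := by
        ring
    _ ≤ 1 := hC.small

/-- The sign record for every smaller non-negative activity. [folklore] -/
private theorem signsL_constsAt {c : B13.Consts} {α₂ B₃ : ℝ} (hs : SignsL c α₂ B₃) (hC3 : 0 ≤ c.C3act) {e : ℝ}
    (he : 0 ≤ e) : SignsL (constsAt c e) α₂ B₃ :=
  ⟨show 0 ≤ c.C3act * e from mul_nonneg hC3 he, hs.α₂_pos, hs.B₃_nonneg, hs.δ₀_pos⟩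

/-- `0 ≤ C₃·ε₁` with `ε₁ > 0` gives `0 ≤ C₃`. [folklore] -/
private theorem C3act_nonneg_of_signsL {c : B13.Consts} {α₂ B₃ : ℝ} (hs : SignsL c α₂ B₃) (hε : 0 < c.ε₁) : 0 ≤ c.C3act := by
  by_contra h
  have : c.C3act * c.ε₁ < 0 := mul_neg_of_neg_of_pos (not_le.mp h) hε
  linarith [hs.A]

/-- **`ObjectsUniform Sβ` — THE PURE OBJECT RESIDUE of the k-uniform remainder bound** (d = 4): ONE cube side `M`, channel `(μ, ν)`,
[II]-record `c` with `c.ε₁ > 0` meeting N1 (`CondsL`), the closing relation, ONE (190)-record `q` meeting N2 (`Valid`, `SignsL`), and —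
the only non-numeric clause — for EVERY activity parameter `e ∈ ]0, c.ε₁]` a box size `γ₀(e) > 0` and an INHABITANT of the torus
remainder chain `ChainTFac190H 4 M μ ν Sβ γ₀ (constsAt c e) ℓ α₂ q` (holomorphic currency): Bałaban's one-step objects with the printed leaves ([II] Lemma 3
(2.38) with activity `C₃ e`, [I] (4.4)/(4.35)/p. 282, [15] (190), (1.7), (1.20)–(1.22)) on the coupling box chosen after `e`.  NO
smallness-versus-slope clause remains (it is produced in `epsUniform_of_objectsUniform`).  A PREDICATE (hypothesis shape), never
asserted; for Bałaban's split no inhabitant exists in the tree.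
[cite: Balaban1988RG2Cluster, Lemma 3 (2.38) p.20 and p.21; Balaban1987RG1, Thm 3 p.264 and (1.20)-(1.22) p.264; Balaban1985Variational, (190) p.308] -/
def ObjectsUniform {β : HBeta} (Sβ : B12Beta.OneLoopSplit β) : Prop :=
  ∃ (M : ℕ) (_ : NeZero M) (μ ν : Fin 4) (c : B13.Consts) (ℓ α₂ : ℝ) (q : Consts190),
    0 < c.ε₁ ∧ CondsL 4 c ℓ ∧ c.R22gen ℓ ∧ q.Valid c.δ₀ ∧ SignsL c α₂ q.B₃ ∧
      ∀ e : ℝ, 0 < e → e ≤ c.ε₁ → ∃ γ₀ : ℝ, 0 < γ₀ ∧ Nonempty (ChainTFac190H 4 M μ ν Sβ γ₀ (constsAt c e) ℓ α₂ q)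

/-- **The pure object residue gives the ε₁-uniform residue** (family `e ↦ constsAt c e` on `]0, c.ε₁]`, bound `K := K_rem,L` at `c`):
every numeric side condition N1–N3 is discharged GENERICALLY in the activity parameter.
[cite: Balaban1988RG2Cluster, p.21 (after (2.39)); Balaban1987RG1, Thm 3 p.264] -/
theorem epsUniform_of_objectsUniform {β : HBeta} {Sβ : B12Beta.OneLoopSplit β} (h : ObjectsUniform Sβ) : EpsUniform Sβ := by
  obtain ⟨M, hM, μ, ν, c, ℓ, α₂, q, hε, hC, h22, hq, hs, hall⟩ := h
  have hC3 : 0 ≤ c.C3act := C3act_nonneg_of_signsL hs hε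
  refine ⟨M, hM, μ, ν, ℓ, α₂, q, remCoeffL 4 M c α₂ q.B₃, c.ε₁, constsAt c, hε, fun e he hle => ?_⟩
  obtain ⟨γ₀, hγ₀, hR⟩ := hall e he hle
  exact ⟨constsAt_eps1 c e, condsL_constsAt hC hC3 hle, h22, hq, signsL_constsAt hs hC3 he.le,
    (remCoeffL_constsAt 4 M c e α₂ q.B₃).le, γ₀, hγ₀, hR⟩

/-- **END TO END at the statement layer**: the pure object residue gives the constant form (D4) AT EVERY POSITIVE SLOPE on some box
inside any prescribed box. [cite: Balaban1987RG1, Thm 2 p.259 and Thm 3 p.264; Balaban1988RG2Cluster, (2.38) p.20 and p.21] -/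
theorem exists_remainderConst_le_of_objectsUniform {β : HBeta} {Sβ : B12Beta.OneLoopSplit β} (h : ObjectsUniform Sβ) {s γc : ℝ}
    (hs : 0 < s) (hγc : 0 < γc) : ∃ γ₁ : ℝ, 0 < γ₁ ∧ γ₁ ≤ γc ∧ RemainderConst Sβ γ₁ s :=
  exists_remainderConst_le_of_epsUniform (epsUniform_of_objectsUniform h) hs hγc

end

end Literature.MathematicalPhysics.QuantumFieldTheory.Balaban1983to89.Beta.RemainderResidue
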